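import Literature.NumberTheory.Transcendental.KZCalculusProofs
import Literature.NumberTheory.Transcendental.KZSemialgebraicComplex
import Literature.NumberTheory.Transcendental.SemialgebraicMapsProofs
import Literature.NumberTheory.Transcendental.EllIterRep

/-!
# Legendre modulus propagation, client L3: `ℚ`-semialgebraicity of the Legendre data

Engine client of the cusp-transport / Hodge-locus engine E2' (`stub_certificateTransport`):
Legendre's family
`F_m(x, y) = 1/√((1-x²)(1-mx²)) · √(1-(1-m)y²)/√(1-y²) + √(1-mx²)/√(1-x²) · 1/√((1-y²)(1-(1-m)y²))
  - 1/√((1-x²)(1-mx²)) · 1/√((1-y²)(1-(1-m)y²))`,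
the potentials `G₁, G₂` and the divergence pieces `g₁ = ∂ₓG₁`, `g₂ = ∂_yG₂` are `ℚ`-semialgebraic
functions of `(x, y, m) ∈ ℝ³` on their natural bands (coordinates `x = z 0`, `y = z 1`, `m = z 2`),
so that all the intermediate integral representations are admissible in the sense of
Kontsevich–Zagier. All five functions are built from coordinates, the rational constants `1, 2`,
`+, -, *, /` and Mathlib's total `Real.sqrt` applied to polynomial expressions, so the statement is
a closure computation (Bochnak–Coste–Roy 1998, Prop. 2.2.6, via Tarski–Seidenberg):
`IsSemialgebraicFunOn.add_holds/sub_holds/mul_holds/sqrt_holds`, `IsSemialgebraicFunOn.div`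
(denominators are shown not to vanish on the bands) and the half-spaces
`KZ.isSemialgebraic_setOf_const_lt_apply` / `KZ.isSemialgebraic_setOf_apply_lt_const` with real
algebraic constants `0, 1, m₀, m₁`.

References: J. Bochnak, M. Coste, M.-F. Roy, *Real Algebraic Geometry* (1998), Prop. 2.2.6;
M. Kontsevich, D. Zagier, *Periods* (2001), §1.1.
-/

noncomputable section
set_option linter.dupNamespace false

namespace Summit.KontsevichZagierPeriods.KontsevichZagierPeriods.CompleteModGammaSectorEngine

open MeasureTheory Set
open Literature.NumberTheory.Transcendental
open Literature.NumberTheory.Transcendental.KZ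
open Literature.ModelTheory.ExponentialFields (IsSemialgebraic)

section Toolbox

variable {n : ℕ} {s : Set (Fin n → ℝ)} {f g : (Fin n → ℝ) → ℝ}

/-- The atoms of the closure computation on a `ℚ`-semialgebraic set: the coordinate functions
and the constant functions `1` and `2` are `ℚ`-semialgebraic (polynomials over `ℚ`). -/
private theorem legendreSA_atoms (hs : IsSemialgebraic ℚ s) :
    (∀ i : Fin n, IsSemialgebraicFunOn ℚ s (fun x => x i)) ∧
      IsSemialgebraicFunOn ℚ s (fun _ => (1 : ℝ)) ∧
        IsSemialgebraicFunOn ℚ s (fun _ => (2 : ℝ)) := by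
  refine ⟨fun i => (isSemialgebraicFunOn_aeval hs (MvPolynomial.X i)).congr fun x _ => by simp,
    ?_, ?_⟩
  · simpa using isSemialgebraicFunOn_natCast (k := ℚ) (R := ℝ) hs 1
  · simpa using isSemialgebraicFunOn_natCast (k := ℚ) (R := ℝ) hs 2

/-- Sums of `ℚ`-semialgebraic functions (compositional form of `add_holds`). -/
private theorem legendreSA_add (hf : IsSemialgebraicFunOn ℚ s f)
    (hg : IsSemialgebraicFunOn ℚ s g) : IsSemialgebraicFunOn ℚ s (fun x => f x + g x) :=
  IsSemialgebraicFunOn.add_holds hf hg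

/-- Differences of `ℚ`-semialgebraic functions (compositional form of `sub_holds`). -/
private theorem legendreSA_sub (hf : IsSemialgebraicFunOn ℚ s f)
    (hg : IsSemialgebraicFunOn ℚ s g) : IsSemialgebraicFunOn ℚ s (fun x => f x - g x) :=
  IsSemialgebraicFunOn.sub_holds hf hg

/-- Products of `ℚ`-semialgebraic functions (compositional form of `mul_holds`). -/
private theorem legendreSA_mul (hf : IsSemialgebraicFunOn ℚ s f)
    (hg : IsSemialgebraicFunOn ℚ s g) : IsSemialgebraicFunOn ℚ s (fun x => f x * g x) :=
  IsSemialgebraicFunOn.mul_holds hf hg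

/-- Negatives of `ℚ`-semialgebraic functions (compositional form of `neg`). -/
private theorem legendreSA_neg (hf : IsSemialgebraicFunOn ℚ s f) :
    IsSemialgebraicFunOn ℚ s (fun x => -f x) :=
  hf.neg

/-- Quotients of `ℚ`-semialgebraic functions with non-vanishing denominator. -/
private theorem legendreSA_div (hf : IsSemialgebraicFunOn ℚ s f)
    (hg : IsSemialgebraicFunOn ℚ s g) (h0 : ∀ x ∈ s, g x ≠ 0) :
    IsSemialgebraicFunOn ℚ s (fun x => f x / g x) :=
  hf.div hg h0

/-- The (total, junk-valued) real square root of a `ℚ`-semialgebraic function. -/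
private theorem legendreSA_sqrt (hf : IsSemialgebraicFunOn ℚ s f) :
    IsSemialgebraicFunOn ℚ s (fun x => Real.sqrt (f x)) :=
  IsSemialgebraicFunOn.sqrt_holds hf

/-- Natural powers of a `ℚ`-semialgebraic function. -/
private theorem legendreSA_pow (hf : IsSemialgebraicFunOn ℚ s f) (k : ℕ) :
    IsSemialgebraicFunOn ℚ s (fun x => f x ^ k) := by
  induction k with
  | zero =>
    exact (legendreSA_atoms (IsSemialgebraicFunOn.isSemialgebraic_holds hf)).2.1.congr
      fun x _ => by simp
  | succ k ih =>
    exact (IsSemialgebraicFunOn.mul_holds ih hf).congr fun x _ => by simp [pow_succ]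

/-- Non-vanishing of `√f` from positivity of `f`. -/
private theorem legendreNZ_sqrt (h : ∀ x ∈ s, 0 < f x) : ∀ x ∈ s, Real.sqrt (f x) ≠ 0 :=
  fun x hx => Real.sqrt_ne_zero'.mpr (h x hx)

/-- Non-vanishing of a product. -/
private theorem legendreNZ_mul (hf : ∀ x ∈ s, f x ≠ 0) (hg : ∀ x ∈ s, g x ≠ 0) :
    ∀ x ∈ s, f x * g x ≠ 0 :=
  fun x hx => mul_ne_zero (hf x hx) (hg x hx)

/-- Positivity of a product. -/
private theorem legendrePos_mul (hf : ∀ x ∈ s, 0 < f x) (hg : ∀ x ∈ s, 0 < g x) :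
    ∀ x ∈ s, 0 < f x * g x :=
  fun x hx => mul_pos (hf x hx) (hg x hx)

/-- Non-vanishing from positivity. -/
private theorem legendreNZ_of_pos (hf : ∀ x ∈ s, 0 < f x) : ∀ x ∈ s, f x ≠ 0 :=
  fun x hx => (hf x hx).ne'

/-- The constant `2` does not vanish. -/
private theorem legendreNZ_two : ∀ x ∈ s, (2 : ℝ) ≠ 0 :=
  fun _ _ => two_ne_zero

/-- Closed lower half-space `{x | c ≤ x i}` with real algebraic `c` is `ℚ`-semialgebraic. -/
private theorem legendreHS_const_le_apply {c : ℝ} (hc : IsAlgebraic ℚ c) (i : Fin n) :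
    IsSemialgebraic ℚ {x : Fin n → ℝ | c ≤ x i} := by
  convert (isSemialgebraic_setOf_apply_lt_const hc i).compl using 1
  ext x
  simp

/-- Closed upper half-space `{x | x i ≤ c}` with real algebraic `c` is `ℚ`-semialgebraic. -/
private theorem legendreHS_apply_le_const {c : ℝ} (hc : IsAlgebraic ℚ c) (i : Fin n) :
    IsSemialgebraic ℚ {x : Fin n → ℝ | x i ≤ c} := by
  convert (isSemialgebraic_setOf_const_lt_apply hc i).compl using 1
  ext x
  simp

/-- `0 < 1 - m x²` for `0 < m < 1`, `0 ≤ x ≤ 1`. -/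
private theorem legendre_pos_one_sub_mul_sq {m x : ℝ} (hm0 : 0 < m) (hm1 : m < 1)
    (hx0 : 0 ≤ x) (hx1 : x ≤ 1) : 0 < 1 - m * x ^ 2 := by
  have hx2 : x ^ 2 ≤ 1 := by nlinarith
  nlinarith

/-- `0 < 1 - (1 - m) y²` for `0 < m < 1`, `0 ≤ y ≤ 1`. -/
private theorem legendre_pos_one_sub_one_sub_mul_sq {m y : ℝ} (hm0 : 0 < m) (hm1 : m < 1)
    (hy0 : 0 ≤ y) (hy1 : y ≤ 1) : 0 < 1 - (1 - m) * y ^ 2 := by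
  have hy2 : y ^ 2 ≤ 1 := by nlinarith
  nlinarith

end Toolbox

section Master

variable {S : Set (Fin 3 → ℝ)}

/-- Legendre's family `F` is `ℚ`-semialgebraic on any `ℚ`-semialgebraic `S ⊆ ℝ³` on which
`1 - x²`, `1 - y²`, `1 - m x²`, `1 - (1 - m) y²` are positive. -/
private theorem legendreSA_family (hS : IsSemialgebraic ℚ S) (hP0 : ∀ z ∈ S, 0 < 1 - z 0 ^ 2)
    (hP1 : ∀ z ∈ S, 0 < 1 - z 1 ^ 2) (hP2 : ∀ z ∈ S, 0 < 1 - z 2 * z 0 ^ 2)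
    (hP3 : ∀ z ∈ S, 0 < 1 - (1 - z 2) * z 1 ^ 2) :
    IsSemialgebraicFunOn ℚ S (fun z : Fin 3 → ℝ => (1 / Real.sqrt ((1 - z 0 ^ 2) * (1 - z 2 * z 0 ^ 2)) * (Real.sqrt (1 - (1 - z 2) * z 1 ^ 2) / Real.sqrt (1 - z 1 ^ 2)) + Real.sqrt (1 - z 2 * z 0 ^ 2) / Real.sqrt (1 - z 0 ^ 2) * (1 / Real.sqrt ((1 - z 1 ^ 2) * (1 - (1 - z 2) * z 1 ^ 2))) - 1 / Real.sqrt ((1 - z 0 ^ 2) * (1 - z 2 * z 0 ^ 2)) * (1 / Real.sqrt ((1 - z 1 ^ 2) * (1 - (1 - z 2) * z 1 ^ 2))))) := by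
  obtain ⟨hc, h1, h2⟩ := legendreSA_atoms hS
  apply_rules (maxDepth := 4000) (transparency := .reducible) only [hS, hP0, hP1,
    hP2, hP3, legendreSA_sub, legendreSA_add, legendreSA_neg, legendreSA_div, legendreSA_mul,
    legendreSA_pow, legendreSA_sqrt, hc, h1, h2,
    legendreNZ_two, legendreNZ_sqrt, legendreNZ_mul, legendrePos_mul, legendreNZ_of_pos]

/-- The potential `G₁ = ½ x √(1-x²) y² / (√(1-mx²) √(1-y²) √(1-(1-m)y²))` is `ℚ`-semialgebraic on
any `ℚ`-semialgebraic `S ⊆ ℝ³` on which `1 - y²`, `1 - m x²`, `1 - (1 - m) y²` are positive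
(`1 - x²` may vanish: it only enters the numerator). -/
private theorem legendreSA_potentialX (hS : IsSemialgebraic ℚ S) (hP1 : ∀ z ∈ S, 0 < 1 - z 1 ^ 2)
    (hP2 : ∀ z ∈ S, 0 < 1 - z 2 * z 0 ^ 2) (hP3 : ∀ z ∈ S, 0 < 1 - (1 - z 2) * z 1 ^ 2) :
    IsSemialgebraicFunOn ℚ S (fun z : Fin 3 → ℝ => (1 / 2 * z 0 * Real.sqrt (1 - z 0 ^ 2) * z 1 ^ 2 / (Real.sqrt (1 - z 2 * z 0 ^ 2) * Real.sqrt (1 - z 1 ^ 2) * Real.sqrt (1 - (1 - z 2) * z 1 ^ 2)))) := by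
  obtain ⟨hc, h1, h2⟩ := legendreSA_atoms hS
  apply_rules (maxDepth := 4000) (transparency := .reducible) only [hS, hP1,
    hP2, hP3, legendreSA_sub, legendreSA_add, legendreSA_neg, legendreSA_div, legendreSA_mul,
    legendreSA_pow, legendreSA_sqrt, hc, h1, h2,
    legendreNZ_two, legendreNZ_sqrt, legendreNZ_mul, legendrePos_mul, legendreNZ_of_pos]

/-- The potential `G₂ = -½ x² y √(1-y²) / (√(1-x²) √(1-mx²) √(1-(1-m)y²))` is `ℚ`-semialgebraic on
any `ℚ`-semialgebraic `S ⊆ ℝ³` on which `1 - x²`, `1 - m x²`, `1 - (1 - m) y²` are positive. -/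
private theorem legendreSA_potentialY (hS : IsSemialgebraic ℚ S) (hP0 : ∀ z ∈ S, 0 < 1 - z 0 ^ 2)
    (hP2 : ∀ z ∈ S, 0 < 1 - z 2 * z 0 ^ 2) (hP3 : ∀ z ∈ S, 0 < 1 - (1 - z 2) * z 1 ^ 2) :
    IsSemialgebraicFunOn ℚ S (fun z : Fin 3 → ℝ => (-(1 / 2 * z 0 ^ 2 * z 1 * Real.sqrt (1 - z 1 ^ 2) / (Real.sqrt (1 - z 0 ^ 2) * Real.sqrt (1 - z 2 * z 0 ^ 2) * Real.sqrt (1 - (1 - z 2) * z 1 ^ 2))))) := by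
  obtain ⟨hc, h1, h2⟩ := legendreSA_atoms hS
  apply_rules (maxDepth := 4000) (transparency := .reducible) only [hS, hP0,
    hP2, hP3, legendreSA_sub, legendreSA_add, legendreSA_neg, legendreSA_div, legendreSA_mul,
    legendreSA_pow, legendreSA_sqrt, hc, h1, h2,
    legendreNZ_two, legendreNZ_sqrt, legendreNZ_mul, legendrePos_mul, legendreNZ_of_pos]

/-- The divergence piece `g₁ = ∂ₓG₁` is `ℚ`-semialgebraic on any `ℚ`-semialgebraic `S ⊆ ℝ³` on
which `1 - x²`, `1 - y²`, `1 - m x²`, `1 - (1 - m) y²` are positive. -/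
private theorem legendreSA_divergenceX (hS : IsSemialgebraic ℚ S) (hP0 : ∀ z ∈ S, 0 < 1 - z 0 ^ 2)
    (hP1 : ∀ z ∈ S, 0 < 1 - z 1 ^ 2) (hP2 : ∀ z ∈ S, 0 < 1 - z 2 * z 0 ^ 2)
    (hP3 : ∀ z ∈ S, 0 < 1 - (1 - z 2) * z 1 ^ 2) :
    IsSemialgebraicFunOn ℚ S (fun z : Fin 3 → ℝ => (1 / 2 * z 1 ^ 2 * (1 / (Real.sqrt (1 - z 0 ^ 2) * Real.sqrt (1 - z 2 * z 0 ^ 2))) * (1 / (Real.sqrt (1 - z 1 ^ 2) * Real.sqrt (1 - (1 - z 2) * z 1 ^ 2))) * ((1 - 2 * z 0 ^ 2) + z 2 * z 0 ^ 2 * (1 - z 0 ^ 2) / (1 - z 2 * z 0 ^ 2)))) := by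
  obtain ⟨hc, h1, h2⟩ := legendreSA_atoms hS
  apply_rules (maxDepth := 4000) (transparency := .reducible) only [hS, hP0, hP1,
    hP2, hP3, legendreSA_sub, legendreSA_add, legendreSA_neg, legendreSA_div, legendreSA_mul,
    legendreSA_pow, legendreSA_sqrt, hc, h1, h2,
    legendreNZ_two, legendreNZ_sqrt, legendreNZ_mul, legendrePos_mul, legendreNZ_of_pos]

/-- The divergence piece `g₂ = ∂_yG₂` is `ℚ`-semialgebraic on any `ℚ`-semialgebraic `S ⊆ ℝ³` on
which `1 - x²`, `1 - y²`, `1 - m x²`, `1 - (1 - m) y²` are positive. -/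
private theorem legendreSA_divergenceY (hS : IsSemialgebraic ℚ S) (hP0 : ∀ z ∈ S, 0 < 1 - z 0 ^ 2)
    (hP1 : ∀ z ∈ S, 0 < 1 - z 1 ^ 2) (hP2 : ∀ z ∈ S, 0 < 1 - z 2 * z 0 ^ 2)
    (hP3 : ∀ z ∈ S, 0 < 1 - (1 - z 2) * z 1 ^ 2) :
    IsSemialgebraicFunOn ℚ S (fun z : Fin 3 → ℝ => (-(1 / 2 * z 0 ^ 2 * (1 / (Real.sqrt (1 - z 0 ^ 2) * Real.sqrt (1 - z 2 * z 0 ^ 2))) * (1 / (Real.sqrt (1 - z 1 ^ 2) * Real.sqrt (1 - (1 - z 2) * z 1 ^ 2))) * ((1 - 2 * z 1 ^ 2) + (1 - z 2) * z 1 ^ 2 * (1 - z 1 ^ 2) / (1 - (1 - z 2) * z 1 ^ 2))))) := by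
  obtain ⟨hc, h1, h2⟩ := legendreSA_atoms hS
  apply_rules (maxDepth := 4000) (transparency := .reducible) only [hS, hP0, hP1,
    hP2, hP3, legendreSA_sub, legendreSA_add, legendreSA_neg, legendreSA_div, legendreSA_mul,
    legendreSA_pow, legendreSA_sqrt, hc, h1, h2,
    legendreNZ_two, legendreNZ_sqrt, legendreNZ_mul, legendrePos_mul, legendreNZ_of_pos]

end Master

section Main

/-- ℚ-semialgebraicity of F, G₁, G₂ on their bands and of g₁, g₂ on the open band (Real.sqrt junk-safe: `IsSemialgebraicFunOn.sqrt_holds`, `.div`, toolbox SemialgebraicRpow p98229) -/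
theorem stub_legendreSemialgebraic :
    ∀ (m₀ m₁ : ℝ), IsAlgebraic ℚ m₀ → IsAlgebraic ℚ m₁ → 0 < m₀ → m₀ < m₁ → m₁ < 1 → IsSemialgebraicFunOn ℚ {z : Fin 3 → ℝ | (∀ i : Fin 2, z (Fin.castSucc i) ∈ Set.Ioo (0:ℝ) 1) ∧ z (Fin.last 2) ∈ Set.Icc m₀ m₁} (fun z : Fin 3 → ℝ => (1 / Real.sqrt ((1 - z 0 ^ 2) * (1 - z 2 * z 0 ^ 2)) * (Real.sqrt (1 - (1 - z 2) * z 1 ^ 2) / Real.sqrt (1 - z 1 ^ 2)) + Real.sqrt (1 - z 2 * z 0 ^ 2) / Real.sqrt (1 - z 0 ^ 2) * (1 / Real.sqrt ((1 - z 1 ^ 2) * (1 - (1 - z 2) * z 1 ^ 2))) - 1 / Real.sqrt ((1 - z 0 ^ 2) * (1 - z 2 * z 0 ^ 2)) * (1 / Real.sqrt ((1 - z 1 ^ 2) * (1 - (1 - z 2) * z 1 ^ 2))))) ∧ IsSemialgebraicFunOn ℚ {z : Fin 3 → ℝ | (∀ j : Fin 2, j ≠ 0 → z (Fin.castSucc j)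 ∈ Set.Ioo (0:ℝ) 1) ∧ z (Fin.castSucc 0) ∈ Set.Icc (0:ℝ) 1 ∧ z (Fin.last 2) ∈ Set.Ioo m₀ m₁} (fun z : Fin 3 → ℝ => (1 / 2 * z 0 * Real.sqrt (1 - z 0 ^ 2) * z 1 ^ 2 / (Real.sqrt (1 - z 2 * z 0 ^ 2) * Real.sqrt (1 - z 1 ^ 2) * Real.sqrt (1 - (1 - z 2) * z 1 ^ 2)))) ∧ IsSemialgebraicFunOn ℚ {z : Fin 3 → ℝ | (∀ j : Fin 2, j ≠ 1 → z (Fin.castSucc j) ∈ Set.Ioo (0:ℝ) 1) ∧ z (Fin.castSucc 1) ∈ Set.Icc (0:ℝ) 1 ∧ z (Fin.last 2) ∈ Set.Ioo m₀ m₁} (fun z : Fin 3 → ℝ => (-(1 / 2 * z 0 ^ 2 * z 1 * Real.sqrt (1 - z 1 ^ 2) / (Real.sqrt (1 - z 0 ^ 2) * Real.sqrt (1 - z 2 * z 0 ^ 2) * Real.sqrt (1 - (1 - z 2) * z 1 ^ 2))))) ∧ IsSemialgebraicFunOn ℚ {z : Fin 3 → ℝ | (∀ j : Fin 2, z (Fin.castSucc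 j) ∈ Set.Ioo (0:ℝ) 1) ∧ z (Fin.last 2) ∈ Set.Ioo m₀ m₁} (fun z : Fin 3 → ℝ => (1 / 2 * z 1 ^ 2 * (1 / (Real.sqrt (1 - z 0 ^ 2) * Real.sqrt (1 - z 2 * z 0 ^ 2))) * (1 / (Real.sqrt (1 - z 1 ^ 2) * Real.sqrt (1 - (1 - z 2) * z 1 ^ 2))) * ((1 - 2 * z 0 ^ 2) + z 2 * z 0 ^ 2 * (1 - z 0 ^ 2) / (1 - z 2 * z 0 ^ 2)))) ∧ IsSemialgebraicFunOn ℚ {z : Fin 3 → ℝ | (∀ j : Fin 2, z (Fin.castSucc j) ∈ Set.Ioo (0:ℝ) 1) ∧ z (Fin.last 2) ∈ Set.Ioo m₀ m₁} (fun z : Fin 3 → ℝ => (-(1 / 2 * z 0 ^ 2 * (1 / (Real.sqrt (1 - z 0 ^ 2) * Real.sqrt (1 - z 2 * z 0 ^ 2))) * (1 / (Real.sqrt (1 - z 1 ^ 2) * Real.sqrt (1 - (1 - z 2) * z 1 ^ 2))) * ((1 - 2 * z 1 ^ 2) + (1 - z 2) * z 1 ^ 2 * (1 - z 1 ^ 2)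 / (1 - (1 - z 2) * z 1 ^ 2))))) := by
  intro m₀ m₁ hm₀ hm₁ h0 h01 h1
  -- coordinates `Fin.castSucc 0 = 0`, `Fin.castSucc 1 = 1`, `Fin.last 2 = 2` in `Fin 3`
  have hc0 : (Fin.castSucc (0 : Fin 2) : Fin 3) = 0 := rfl
  have hc1 : (Fin.castSucc (1 : Fin 2) : Fin 3) = 1 := rfl
  have hl2 : (Fin.last 2 : Fin 3) = 2 := rfl
  have h10 : ¬ ((1 : Fin 2) = 0) := by decide
  have h01' : ¬ ((0 : Fin 2) = 1) := by decide
  -- the half-spaces (real algebraic constants `0, 1, m₀, m₁`)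
  have L0 : IsSemialgebraic ℚ {z : Fin 3 → ℝ | 0 < z 0} :=
    isSemialgebraic_setOf_const_lt_apply isAlgebraic_zero 0
  have U0 : IsSemialgebraic ℚ {z : Fin 3 → ℝ | z 0 < 1} :=
    isSemialgebraic_setOf_apply_lt_const isAlgebraic_one 0
  have L1 : IsSemialgebraic ℚ {z : Fin 3 → ℝ | 0 < z 1} :=
    isSemialgebraic_setOf_const_lt_apply isAlgebraic_zero 1
  have U1 : IsSemialgebraic ℚ {z : Fin 3 → ℝ | z 1 < 1} :=
    isSemialgebraic_setOf_apply_lt_const isAlgebraic_one 1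
  have L0' : IsSemialgebraic ℚ {z : Fin 3 → ℝ | 0 ≤ z 0} :=
    legendreHS_const_le_apply isAlgebraic_zero 0
  have U0' : IsSemialgebraic ℚ {z : Fin 3 → ℝ | z 0 ≤ 1} :=
    legendreHS_apply_le_const isAlgebraic_one 0
  have L1' : IsSemialgebraic ℚ {z : Fin 3 → ℝ | 0 ≤ z 1} :=
    legendreHS_const_le_apply isAlgebraic_zero 1
  have U1' : IsSemialgebraic ℚ {z : Fin 3 → ℝ | z 1 ≤ 1} :=
    legendreHS_apply_le_const isAlgebraic_one 1
  have L2 : IsSemialgebraic ℚ {z : Fin 3 → ℝ | m₀ < z 2} :=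
    isSemialgebraic_setOf_const_lt_apply hm₀ 2
  have U2 : IsSemialgebraic ℚ {z : Fin 3 → ℝ | z 2 < m₁} :=
    isSemialgebraic_setOf_apply_lt_const hm₁ 2
  have L2' : IsSemialgebraic ℚ {z : Fin 3 → ℝ | m₀ ≤ z 2} :=
    legendreHS_const_le_apply hm₀ 2
  have U2' : IsSemialgebraic ℚ {z : Fin 3 → ℝ | z 2 ≤ m₁} :=
    legendreHS_apply_le_const hm₁ 2
  -- the four bands as finite intersections of half-spaces
  have e1 : {z : Fin 3 → ℝ | (∀ i : Fin 2, z (Fin.castSucc i) ∈ Set.Ioo (0:ℝ) 1) ∧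
      z (Fin.last 2) ∈ Set.Icc m₀ m₁} = (({z | 0 < z 0} ∩ {z | z 0 < 1}) ∩
        ({z | 0 < z 1} ∩ {z | z 1 < 1})) ∩ ({z | m₀ ≤ z 2} ∩ {z | z 2 ≤ m₁}) := by
    ext z
    simp [Fin.forall_fin_two, hc0, hc1, hl2, and_assoc]
  have e2 : {z : Fin 3 → ℝ | (∀ j : Fin 2, j ≠ 0 → z (Fin.castSucc j) ∈ Set.Ioo (0:ℝ) 1) ∧
      z (Fin.castSucc 0) ∈ Set.Icc (0:ℝ) 1 ∧ z (Fin.last 2) ∈ Set.Ioo m₀ m₁} =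
        ({z | 0 < z 1} ∩ {z | z 1 < 1}) ∩ (({z | 0 ≤ z 0} ∩ {z | z 0 ≤ 1}) ∩
          ({z | m₀ < z 2} ∩ {z | z 2 < m₁})) := by
    ext z
    simp [Fin.forall_fin_two, hc0, hc1, hl2, h10, and_assoc]
  have e3 : {z : Fin 3 → ℝ | (∀ j : Fin 2, j ≠ 1 → z (Fin.castSucc j) ∈ Set.Ioo (0:ℝ) 1) ∧
      z (Fin.castSucc 1) ∈ Set.Icc (0:ℝ) 1 ∧ z (Fin.last 2) ∈ Set.Ioo m₀ m₁} =
        ({z | 0 < z 0} ∩ {z | z 0 < 1}) ∩ (({z | 0 ≤ z 1} ∩ {z | z 1 ≤ 1}) ∩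
          ({z | m₀ < z 2} ∩ {z | z 2 < m₁})) := by
    ext z
    simp [Fin.forall_fin_two, hc0, hc1, hl2, h01', and_assoc]
  have e4 : {z : Fin 3 → ℝ | (∀ j : Fin 2, z (Fin.castSucc j) ∈ Set.Ioo (0:ℝ) 1) ∧
      z (Fin.last 2) ∈ Set.Ioo m₀ m₁} = (({z | 0 < z 0} ∩ {z | z 0 < 1}) ∩
        ({z | 0 < z 1} ∩ {z | z 1 < 1})) ∩ ({z | m₀ < z 2} ∩ {z | z 2 < m₁}) := by
    ext z
    simp [Fin.forall_fin_two, hc0, hc1, hl2, and_assoc]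
  have hT1 := ((L0.inter U0).inter (L1.inter U1)).inter (L2'.inter U2')
  have hT2 := (L1.inter U1).inter ((L0'.inter U0').inter (L2.inter U2))
  have hT3 := (L0.inter U0).inter ((L1'.inter U1').inter (L2.inter U2))
  have hT4 := ((L0.inter U0).inter (L1.inter U1)).inter (L2.inter U2)
  refine ⟨?_, ?_, ?_, ?_, ?_⟩
  · rw [e1]
    refine legendreSA_family hT1 ?_ ?_ ?_ ?_
    · rintro z ⟨⟨⟨hx0 : 0 < z 0, hx1 : z 0 < 1⟩, -⟩, -⟩
      nlinarith
    · rintro z ⟨⟨-, hy0 : 0 < z 1, hy1 : z 1 < 1⟩, -⟩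
      nlinarith
    · rintro z ⟨⟨⟨hx0 : 0 < z 0, hx1 : z 0 < 1⟩, -⟩, hm0 : m₀ ≤ z 2, hm1 : z 2 ≤ m₁⟩
      exact legendre_pos_one_sub_mul_sq (h0.trans_le hm0) (hm1.trans_lt h1) hx0.le hx1.le
    · rintro z ⟨⟨-, hy0 : 0 < z 1, hy1 : z 1 < 1⟩, hm0 : m₀ ≤ z 2, hm1 : z 2 ≤ m₁⟩
      exact legendre_pos_one_sub_one_sub_mul_sq (h0.trans_le hm0) (hm1.trans_lt h1) hy0.le
        hy1.le
  · rw [e2]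
    refine legendreSA_potentialX hT2 ?_ ?_ ?_
    · rintro z ⟨⟨hy0 : 0 < z 1, hy1 : z 1 < 1⟩, -⟩
      nlinarith
    · rintro z ⟨-, ⟨hx0 : 0 ≤ z 0, hx1 : z 0 ≤ 1⟩, hm0 : m₀ < z 2, hm1 : z 2 < m₁⟩
      exact legendre_pos_one_sub_mul_sq (h0.trans hm0) (hm1.trans h1) hx0 hx1
    · rintro z ⟨⟨hy0 : 0 < z 1, hy1 : z 1 < 1⟩, -, hm0 : m₀ < z 2, hm1 : z 2 < m₁⟩
      exact legendre_pos_one_sub_one_sub_mul_sq (h0.trans hm0) (hm1.trans h1) hy0.le hy1.le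
  · rw [e3]
    refine legendreSA_potentialY hT3 ?_ ?_ ?_
    · rintro z ⟨⟨hx0 : 0 < z 0, hx1 : z 0 < 1⟩, -⟩
      nlinarith
    · rintro z ⟨⟨hx0 : 0 < z 0, hx1 : z 0 < 1⟩, -, hm0 : m₀ < z 2, hm1 : z 2 < m₁⟩
      exact legendre_pos_one_sub_mul_sq (h0.trans hm0) (hm1.trans h1) hx0.le hx1.le
    · rintro z ⟨-, ⟨hy0 : 0 ≤ z 1, hy1 : z 1 ≤ 1⟩, hm0 : m₀ < z 2, hm1 : z 2 < m₁⟩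
      exact legendre_pos_one_sub_one_sub_mul_sq (h0.trans hm0) (hm1.trans h1) hy0 hy1
  · rw [e4]
    refine legendreSA_divergenceX hT4 ?_ ?_ ?_ ?_
    · rintro z ⟨⟨⟨hx0 : 0 < z 0, hx1 : z 0 < 1⟩, -⟩, -⟩
      nlinarith
    · rintro z ⟨⟨-, hy0 : 0 < z 1, hy1 : z 1 < 1⟩, -⟩
      nlinarith
    · rintro z ⟨⟨⟨hx0 : 0 < z 0, hx1 : z 0 < 1⟩, -⟩, hm0 : m₀ < z 2, hm1 : z 2 < m₁⟩
      exact legendre_pos_one_sub_mul_sq (h0.trans hm0) (hm1.trans h1) hx0.le hx1.le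
    · rintro z ⟨⟨-, hy0 : 0 < z 1, hy1 : z 1 < 1⟩, hm0 : m₀ < z 2, hm1 : z 2 < m₁⟩
      exact legendre_pos_one_sub_one_sub_mul_sq (h0.trans hm0) (hm1.trans h1) hy0.le hy1.le
  · rw [e4]
    refine legendreSA_divergenceY hT4 ?_ ?_ ?_ ?_
    · rintro z ⟨⟨⟨hx0 : 0 < z 0, hx1 : z 0 < 1⟩, -⟩, -⟩
      nlinarith
    · rintro z ⟨⟨-, hy0 : 0 < z 1, hy1 : z 1 < 1⟩, -⟩
      nlinarith
    · rintro z ⟨⟨⟨hx0 : 0 < z 0, hx1 : z 0 < 1⟩, -⟩, hm0 : m₀ < z 2, hm1 : z 2 < m₁⟩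
      exact legendre_pos_one_sub_mul_sq (h0.trans hm0) (hm1.trans h1) hx0.le hx1.le
    · rintro z ⟨⟨-, hy0 : 0 < z 1, hy1 : z 1 < 1⟩, hm0 : m₀ < z 2, hm1 : z 2 < m₁⟩
      exact legendre_pos_one_sub_one_sub_mul_sq (h0.trans hm0) (hm1.trans h1) hy0.le hy1.le

end Main


end Summit.KontsevichZagierPeriods.KontsevichZagierPeriods.CompleteModGammaSectorEngine
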